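import Literature.NumberTheory.Rogawski1990.RationalClassesInjectAdelically
import Literature.NumberTheory.Rogawski1990.SingularSemisimpleElement
import Literature.NumberTheory.Automorphic.UnitaryGroupBlockCentralizer
import Literature.NumberTheory.QuadraticForms.HermitianCongruenceOfLocalNorms
import HarnessLib

/-!
# Rational classes inject into adelic classes at the SINGULAR semisimple classes too: `k(γ₀) = 1` for EVERY class of the anisotropic
# `U(H)(L⁺)` in three variables (Rogawski 1990, §3.8 Prop. 3.8.1, §5.4 p. 72, §14.5 pp. 238–239; Kottwitz 1986, §9; Landherr 1936)

Topic `NumberTheory/Rogawski1990`; namespace `Literature.NumberTheory.Rogawski1990`.  THEOREMS ONLY (no def, no named fact, no instance, no `sorry`).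
Cell `pub/hodgecm-mathlib`, ENGINE T1 (crux H413 = `stmt-HodgeConjecture-24833`), row O7 «singular semisimple classes» (A-p01 (g14) CENSUS-O7 v2, step K4,
injectivity half): the SINGULAR twin of ★ F3′ `RationalClassesInjectAdelically` (`UnitaryGroup.injOn_conjClassesMap_toAdelic`, REGULAR `γ₀`).
HC_CM is proved only modulo the printed citations until rung 0 closes.

THE MATHEMATICS.  Let `H ∈ M₃(L)` be anisotropic hermitian over the CM field `L` (`σ` = complex conjugation) and `γ, δ ∈ U(H)(L⁺)` stably conjugate
(`g γ g⁻¹ = δ`, `g ∈ GL₃(L)`) with `γ ⊗ 1`, `δ ⊗ 1` conjugate in `U(H)(𝔸_{L⁺})`.  By ★ F3′ (b) some `t ∈ GL₃(𝔸_L)` commuting with `γ ⊗ 1` has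
`ᵗ(σ_𝔸 t) · (H_g ⊗ 1) · t = H ⊗ 1` (`H_g = ᵗ(σg) H g`), and `γ, δ` are conjugate in `U(H)(L⁺)` iff such a `t` exists over `L` (★ R1
`exists_unitary_conj_iff_exists_commute_congr_eq`).  For `γ` REGULAR the descent `𝔸_L ⇝ L` is Hasse's norm theorem on the Cartan algebra `L[γ]` (★ F3′).
For `γ` SINGULAR, NON-CENTRAL (eigenvalues `{a, a, b}`, [§3.8]): in the adapted frame `P` of ★ `exists_singular_frame_of_anisotropic`
(`γ P = P (a·1₂ ⊕ b·1₁)`, `ᵗ(σP) H P = H_a ⊕ H_b`) everything commuting with `γ` is BLOCK DIAGONAL (★ `eq_finSum_of_commute`, `a − b` a unit of `𝔸_L`):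
`P⁻¹ t P = t_a ⊕ t_b` and `ᵗ(σP) H_g P = G_a ⊕ G_b` (for `H⁻¹ H_g ∈ Z(γ)`, ★ `commute_inv_mul_twistGram`), and the adelic congruence SPLITS into
`ᵗ(σ_𝔸 t_a) (G_a ⊗ 1) t_a = H_a ⊗ 1` (rank 2) and `ᵗ(σ_𝔸 t_b) (G_b ⊗ 1) t_b = H_b ⊗ 1` (rank 1) — two ADELIC CONGRUENCES OF HERMITIAN FORMS, which descend
to `L` by the HASSE PRINCIPLE FOR HERMITIAN FORMS ★ `QuadraticForms.exists_gl_twistGram_eq_of_twistGram_adele'` (Landherr; unconditional in the tree);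
the rational `t₀ := P (s_a ⊕ s_b) P⁻¹` commutes with `γ` and solves `ᵗ(σ t₀) H_g t₀ = H`.  For `γ` CENTRAL, `δ = γ`.  Hence, with NO regularity
hypothesis: **`[δ] ↦ [δ ⊗ 1]` is injective on the `U(H)(L⁺)`-classes inside every stable class** — print's `k(γ₀) = |ker(𝔇(G′_γ₀∕F) → 𝔇(G′_γ₀∕𝐀))| = 1`
at the singular classes [§14.5 p. 239: «`m(Z G′_{γ′}\G′_{γ′}) Σ_{δ ∈ 𝔇_{G′}} Φ(γ^δ, f′)`», the sum being over the RATIONAL classes inside `𝒪_st`, identified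
with a subset of the adelic ones], the `hinj` hypothesis of ★ `PreStabilisationCount{,Self}` at a singular `γ₀`.

* §1 block algebra over `finSum` (★ `UnitaryGroupDirectSum`): products, injectivity, adjoints, determinants, `twistGram` of block-diagonal data, and the
  `GL` form of ★ `eq_finSum_of_commute` (an INVERTIBLE matrix commuting with `a·1 ⊕ b·1` has invertible blocks);
* §2 **`exists_commute_twistGram_eq_of_singular_frame`** — THE DESCENT in matrix letters (frame `P`, hermitian `G` with `H⁻¹G ∈ Z(γ)`, adelic `t`);
* §3 **`UnitaryGroup.isConj_of_isConj_toAdelic_of_not_isRegularElt`** (anisotropic `H`, `γ` stably conjugate to `γ′`, `γ` not regular) and the class form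
  for EVERY `γ₀`: **`UnitaryGroup.injOn_conjClassesMap_toAdelic_of_anisotropic`** (regular by ★ F3′, singular by §2, central trivially).

## References
* [Rogawski1990] J. D. Rogawski, *Automorphic Representations of Unitary Groups in Three Variables*, Ann. of Math. Stud. 123 (1990), §3.1 p. 19, §3.8
  Prop. 3.8.1 p. 27, §5.4 p. 72, §14.5 pp. 238–239.
* [Kottwitz1986] R. E. Kottwitz, *Stable trace formula: elliptic singular terms*, Math. Ann. 275 (1986), §9.
* [Landherr1936HermitianForms] W. Landherr, *Äquivalenz Hermitescher Formen über einem beliebigen algebraischen Zahlkörper*, Abh. Math. Sem. Hamburg 11 (1936).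
-/

set_option autoImplicit false

noncomputable section

open NumberField IsDedekindDomain
open scoped MatrixGroups Matrix

namespace Literature.NumberTheory.Rogawski1990

open Literature.NumberTheory.Automorphic
open Literature.NumberTheory.Automorphic.UnitaryGroup (finSum finSum_map blockDiagGL coe_blockDiagGL eq_finSum_of_commute
  finSum_commute_finSum_smul_one)
open Literature.AlgebraicGeometry.ShimuraVarieties (unitaryGroup)

/-! ## §1 Block algebra over `finSum` -/

section Blocks

variable {S : Type*} [CommRing S] {N₁ N₂ : ℕ}

/-- `(A ⊕ᶠ B)(C ⊕ᶠ D) = AC ⊕ᶠ BD`. [folklore] -/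
private theorem finSum_mul_finSum' (A C : Matrix (Fin N₁) (Fin N₁) S) (B D : Matrix (Fin N₂) (Fin N₂) S) :
    finSum N₁ N₂ A B * finSum N₁ N₂ C D = finSum N₁ N₂ (A * C) (B * D) := by
  simp only [finSum, Matrix.reindex_apply, Matrix.submatrix_mul_equiv, Matrix.fromBlocks_multiply, Matrix.mul_zero, Matrix.zero_mul,
    add_zero, zero_add]

/-- `⊕ᶠ` is injective in the pair of blocks. [folklore] -/
private theorem finSum_injective₂ {A C : Matrix (Fin N₁) (Fin N₁) S} {B D : Matrix (Fin N₂) (Fin N₂) S} (h : finSum N₁ N₂ A B = finSum N₁ N₂ C D) :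
    A = C ∧ B = D := by
  have h' := (Matrix.reindex finSumFinEquiv finSumFinEquiv).injective h
  rw [Matrix.fromBlocks_inj] at h'
  exact ⟨h'.1, h'.2.2.2⟩

/-- `1 ⊕ᶠ 1 = 1`. [folklore] -/
private theorem finSum_one_one' : finSum N₁ N₂ (1 : Matrix (Fin N₁) (Fin N₁) S) (1 : Matrix (Fin N₂) (Fin N₂) S) = 1 := by
  simp only [finSum, Matrix.fromBlocks_one, Matrix.reindex_apply, Matrix.submatrix_one_equiv]

/-- `ᵗ(A ⊕ᶠ B) = ᵗA ⊕ᶠ ᵗB`. [folklore] -/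
private theorem finSum_transpose (A : Matrix (Fin N₁) (Fin N₁) S) (B : Matrix (Fin N₂) (Fin N₂) S) :
    (finSum N₁ N₂ A B)ᵀ = finSum N₁ N₂ Aᵀ Bᵀ := by
  simp only [finSum, Matrix.reindex_apply, Matrix.transpose_submatrix, Matrix.fromBlocks_transpose, Matrix.transpose_zero]

/-- The `σ`-adjoint of a block-diagonal matrix: `ᵗ(σ(A ⊕ᶠ B)) = ᵗ(σA) ⊕ᶠ ᵗ(σB)`. [folklore] -/
private theorem finSum_conjTranspose (σ : S →+* S) (A : Matrix (Fin N₁) (Fin N₁) S) (B : Matrix (Fin N₂) (Fin N₂) S) :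
    ((finSum N₁ N₂ A B).map σ)ᵀ = finSum N₁ N₂ ((A.map σ)ᵀ) ((B.map σ)ᵀ) := by
  rw [finSum_map, finSum_transpose]

/-- **`twistGram` of block-diagonal data is block diagonal**: `ᵗ(σ(t₁ ⊕ t₂)) (J₁ ⊕ J₂) (t₁ ⊕ t₂) = ᵗ(σt₁) J₁ t₁ ⊕ ᵗ(σt₂) J₂ t₂`. [folklore] -/
private theorem twistGram_finSum_finSum (σ : S →+* S) (J₁ t₁ : Matrix (Fin N₁) (Fin N₁) S) (J₂ t₂ : Matrix (Fin N₂) (Fin N₂) S) :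
    twistGram σ (finSum N₁ N₂ J₁ J₂) (finSum N₁ N₂ t₁ t₂) = finSum N₁ N₂ (twistGram σ J₁ t₁) (twistGram σ J₂ t₂) := by
  rw [twistGram_def, finSum_conjTranspose, finSum_mul_finSum', finSum_mul_finSum', twistGram_def, twistGram_def]

/-- `det (A ⊕ᶠ B) = det A · det B`. [folklore] -/
private theorem det_finSum' (A : Matrix (Fin N₁) (Fin N₁) S) (B : Matrix (Fin N₂) (Fin N₂) S) : (finSum N₁ N₂ A B).det = A.det * B.det := by
  rw [finSum, Matrix.det_reindex_self, Matrix.det_fromBlocks_zero₂₁]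

/-- A block scalar under a change of rings: `(a·1 ⊕ᶠ b·1).map f = f(a)·1 ⊕ᶠ f(b)·1`. [folklore] -/
private theorem finSum_smul_one_map {S' : Type*} [CommRing S'] (f : S →+* S') (a b : S) :
    (finSum N₁ N₂ (a • (1 : Matrix (Fin N₁) (Fin N₁) S)) (b • (1 : Matrix (Fin N₂) (Fin N₂) S))).map f =
      finSum N₁ N₂ (f a • (1 : Matrix (Fin N₁) (Fin N₁) S')) (f b • (1 : Matrix (Fin N₂) (Fin N₂) S')) := by
  rw [finSum_map]
  congr 1 <;> rw [Matrix.map_smul' _ _ _ (map_mul f), Matrix.map_one _ (map_zero f) (map_one f)]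

/-- **An INVERTIBLE matrix commuting with the block scalar `a·1 ⊕ᶠ b·1` (`a − b` a unit) has invertible blocks**: `t = t₁ ⊕ᶠ t₂` with `t₁, t₂`
invertible (★ `eq_finSum_of_commute` for `t` and `t⁻¹`, the blocks being mutually inverse). [cite: Rogawski1990, §3.8 Prop. 3.8.1 p. 27] -/
theorem exists_units_eq_finSum_of_commute {a b : S} (hab : IsUnit (a - b)) (t : GL (Fin (N₁ + N₂)) S)
    (ht : (t : Matrix (Fin (N₁ + N₂)) (Fin (N₁ + N₂)) S) * finSum N₁ N₂ (a • (1 : Matrix (Fin N₁) (Fin N₁) S)) (b • 1) =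
      finSum N₁ N₂ (a • (1 : Matrix (Fin N₁) (Fin N₁) S)) (b • 1) * (t : Matrix (Fin (N₁ + N₂)) (Fin (N₁ + N₂)) S)) :
    ∃ (t₁ : GL (Fin N₁) S) (t₂ : GL (Fin N₂) S),
      (t : Matrix (Fin (N₁ + N₂)) (Fin (N₁ + N₂)) S) = finSum N₁ N₂ (t₁ : Matrix (Fin N₁) (Fin N₁) S) (t₂ : Matrix (Fin N₂) (Fin N₂) S) := by
  obtain ⟨x₁, x₂, hx⟩ := eq_finSum_of_commute hab _ ht
  have ht' : ((t⁻¹ : GL _ S) : Matrix _ _ S) * finSum N₁ N₂ (a • (1 : Matrix (Fin N₁) (Fin N₁) S)) (b • 1) =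
      finSum N₁ N₂ (a • (1 : Matrix (Fin N₁) (Fin N₁) S)) (b • 1) * ((t⁻¹ : GL _ S) : Matrix _ _ S) := by
    have h := congrArg (fun M => ((t⁻¹ : GL _ S) : Matrix _ _ S) * M * ((t⁻¹ : GL _ S) : Matrix _ _ S)) ht
    simp only [← Matrix.mul_assoc, Matrix.coe_units_inv, Matrix.nonsing_inv_mul _ (Matrix.isUnits_det_units _), Matrix.one_mul] at h
    simp only [Matrix.mul_assoc, Matrix.mul_nonsing_inv _ (Matrix.isUnits_det_units _), Matrix.mul_one] at h
    rw [← Matrix.coe_units_inv] at h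
    exact h.symm
  obtain ⟨y₁, y₂, hy⟩ := eq_finSum_of_commute hab _ ht'
  have hxy : x₁ * y₁ = 1 ∧ x₂ * y₂ = 1 := by
    apply finSum_injective₂
    rw [← finSum_mul_finSum', ← hx, ← hy, ← Units.val_mul, mul_inv_cancel, Units.val_one, finSum_one_one']
  have hyx : y₁ * x₁ = 1 ∧ y₂ * x₂ = 1 := by
    apply finSum_injective₂
    rw [← finSum_mul_finSum', ← hx, ← hy, ← Units.val_mul, inv_mul_cancel, Units.val_one, finSum_one_one']
  exact ⟨⟨x₁, y₁, hxy.1, hyx.1⟩, ⟨x₂, y₂, hxy.2, hyx.2⟩, hx⟩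

end Blocks

/-! ## §2 The descent for a singular, non-central, semisimple `γ`: block by block through the Hasse principle for hermitian forms -/

section Descent

variable {L : Type} [Field L] [NumberField L] [IsCMField L]

/-- Conjugating two commuting matrices by the same invertible matrix. [folklore] -/
private theorem conj_mul_conj_comm {R : Type*} [CommRing R] {n : Type*} [Fintype n] [DecidableEq n] (P : GL n R) {x y : Matrix n n R}
    (h : x * y = y * x) :
    ((P⁻¹ : GL n R) : Matrix n n R) * x * (P : Matrix n n R) * (((P⁻¹ : GL n R) : Matrix n n R) * y * (P : Matrix n n R)) =
      ((P⁻¹ : GL n R) : Matrix n n R) * y * (P : Matrix n n R) * (((P⁻¹ : GL n R) : Matrix n n R) * x * (P : Matrix n n R)) := by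
  calc ((P⁻¹ : GL n R) : Matrix n n R) * x * (P : Matrix n n R) * (((P⁻¹ : GL n R) : Matrix n n R) * y * (P : Matrix n n R))
        = ((P⁻¹ : GL n R) : Matrix n n R) * (x * y) * (P : Matrix n n R) := by
          simp only [Matrix.mul_assoc, Units.mul_inv_cancel_left]
    _ = ((P⁻¹ : GL n R) : Matrix n n R) * (y * x) * (P : Matrix n n R) := by rw [h]
    _ = ((P⁻¹ : GL n R) : Matrix n n R) * y * (P : Matrix n n R) * (((P⁻¹ : GL n R) : Matrix n n R) * x * (P : Matrix n n R)) := by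
          simp only [Matrix.mul_assoc, Units.mul_inv_cancel_left]

/-- **THE DESCENT AT A SINGULAR NON-CENTRAL CLASS.**  `H ∈ M₃(L)` invertible; `γ` with an adapted frame `P ∈ GL₃(L)`: `γ P = P (a·1₂ ⊕ᶠ b·1₁)` with `a ≠ b`
and `ᵗ(σP) H P = H_a ⊕ᶠ H_b` (`H_a`, `H_b` hermitian non-degenerate; ★ `exists_singular_frame_of_anisotropic`); `G` hermitian invertible with `H⁻¹ G ∈ Z(γ)`
(for `G = H_g = ᵗ(σg) H g`, `g γ g⁻¹ = δ`: ★ `commute_inv_mul_twistGram`); and an ADELIC `t ∈ GL₃(𝔸_L)` commuting with `γ ⊗ 1` with `ᵗ(σ_𝔸 t) (G ⊗ 1) t = H ⊗ 1`.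
THEN a RATIONAL `t₀ ∈ GL₃(L)` commutes with `γ` and has `ᵗ(σ t₀) G t₀ = H`: in the frame, `t` and `ᵗ(σP) G P` are block diagonal, the adelic congruence
splits into a rank-`2` and a rank-`1` adelic congruence of hermitian forms, and each descends to `L` by ★ `QuadraticForms.exists_gl_twistGram_eq_of_twistGram_adele'`
(Landherr's Hasse principle). [cite: Rogawski1990, §3.8 Prop. 3.8.1 p. 27; §5.4 p. 72] [cite: Kottwitz1986, §9] [cite: Landherr1936HermitianForms] -/
theorem exists_commute_twistGram_eq_of_singular_frame
    {H : Matrix (Fin 3) (Fin 3) L} (hHdet : IsUnit H.det)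
    {γ : Matrix (Fin 3) (Fin 3) L} {P : GL (Fin 3) L} {a b : L} {Ha : Matrix (Fin 2) (Fin 2) L} {Hb : Matrix (Fin 1) (Fin 1) L}
    (hab : a ≠ b) (hHa : (Ha.map (cmConjRingHom L))ᵀ = Ha) (hHb : (Hb.map (cmConjRingHom L))ᵀ = Hb) (hHa0 : Ha.det ≠ 0) (hHb0 : Hb.det ≠ 0)
    (hP : ((P : Matrix (Fin 3) (Fin 3) L).map (cmConjRingHom L))ᵀ * H * (P : Matrix (Fin 3) (Fin 3) L) = finSum 2 1 Ha Hb)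
    (hγP : γ * (P : Matrix (Fin 3) (Fin 3) L) =
      (P : Matrix (Fin 3) (Fin 3) L) * finSum 2 1 (a • (1 : Matrix (Fin 2) (Fin 2) L)) (b • (1 : Matrix (Fin 1) (Fin 1) L)))
    {G : Matrix (Fin 3) (Fin 3) L} (hG : (G.map (cmConjRingHom L))ᵀ = G) (hGdet : IsUnit G.det) (hGγ : H⁻¹ * G * γ = γ * (H⁻¹ * G))
    (t : GL (Fin 3) (AdeleRing (𝓞 L) L))
    (ht : (t : Matrix (Fin 3) (Fin 3) (AdeleRing (𝓞 L) L)) * γ.map (algebraMap L (AdeleRing (𝓞 L) L)) =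
      γ.map (algebraMap L (AdeleRing (𝓞 L) L)) * (t : Matrix (Fin 3) (Fin 3) (AdeleRing (𝓞 L) L)))
    (htG : twistGram (adeleConj L) (G.map (algebraMap L (AdeleRing (𝓞 L) L))) (t : Matrix (Fin 3) (Fin 3) (AdeleRing (𝓞 L) L)) =
      H.map (algebraMap L (AdeleRing (𝓞 L) L))) :
    ∃ t₀ : GL (Fin 3) L, (t₀ : Matrix (Fin 3) (Fin 3) L) * γ = γ * (t₀ : Matrix (Fin 3) (Fin 3) L) ∧
      twistGram (cmConjRingHom L) G (t₀ : Matrix (Fin 3) (Fin 3) L) = H := by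
  classical
  -- names
  set σ : L →+* L := cmConjRingHom L with hσdef
  set ι : L →+* AdeleRing (𝓞 L) L := algebraMap L (AdeleRing (𝓞 L) L) with hι
  set σA : AdeleRing (𝓞 L) L →+* AdeleRing (𝓞 L) L := adeleConj L with hσA
  have hσσ : ∀ r : L, σ (σ r) = r := fun r => IsCMField.complexConj_apply_apply L r
  have hισ : ∀ r : L, ι (σ r) = σA (ι r) := fun r => (adeleConj_algebraMap L r).symm
  set Pm : Matrix (Fin 3) (Fin 3) L := (P : Matrix (Fin 3) (Fin 3) L) with hPm
  set Pi : Matrix (Fin 3) (Fin 3) L := ((P⁻¹ : GL (Fin 3) L) : Matrix (Fin 3) (Fin 3) L) with hPi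
  have hPiPm : Pi * Pm = 1 := Units.inv_mul P
  have hPmPi : Pm * Pi = 1 := Units.mul_inv P
  have hPmPi' : ∀ M : Matrix (Fin 3) (Fin 3) L, Pm * (Pi * M) = M := fun M => by rw [← Matrix.mul_assoc, hPmPi, Matrix.one_mul]
  have hPiPm' : ∀ M : Matrix (Fin 3) (Fin 3) L, Pi * (Pm * M) = M := fun M => by rw [← Matrix.mul_assoc, hPiPm, Matrix.one_mul]
  set D : Matrix (Fin 3) (Fin 3) L := finSum 2 1 (a • (1 : Matrix (Fin 2) (Fin 2) L)) (b • (1 : Matrix (Fin 1) (Fin 1) L)) with hD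
  -- (i) `P⁻¹ γ P = D`, `γ = P D P⁻¹`
  have hPγP : Pi * γ * Pm = D := by
    rw [Matrix.mul_assoc, hγP, ← Matrix.mul_assoc, hPiPm, Matrix.one_mul]
  have hγ : γ = Pm * D * Pi := by
    rw [← hPγP]
    simp only [Matrix.mul_assoc, hPmPi', hPmPi, Matrix.mul_one]
  -- (ii) `x := H⁻¹ G` conjugated into the frame is block diagonal
  set x : Matrix (Fin 3) (Fin 3) L := H⁻¹ * G with hx
  have hx' : Pi * x * Pm * D = D * (Pi * x * Pm) := by
    rw [← hPγP]
    exact conj_mul_conj_comm P hGγ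
  have hab' : IsUnit (a - b) := (sub_ne_zero.mpr hab).isUnit
  rw [hD] at hx'
  obtain ⟨ya, yb, hy⟩ := eq_finSum_of_commute (N₁ := 2) (N₂ := 1) hab' (Pi * x * Pm) hx'
  -- the blocks of `x` are invertible
  have hxdet : IsUnit x.det := by
    rw [hx, Matrix.det_mul]
    exact (Matrix.isUnit_nonsing_inv_det H hHdet).mul hGdet
  have hydet : IsUnit ya.det ∧ IsUnit yb.det := by
    have h : IsUnit (finSum 2 1 ya yb).det := by
      rw [← hy, Matrix.det_mul, Matrix.det_mul]
      exact ((Matrix.isUnits_det_units (P⁻¹)).mul hxdet).mul (Matrix.isUnits_det_units P)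
    rw [det_finSum'] at h
    exact IsUnit.mul_iff.mp h
  -- (iii) `G′ := ᵗ(σP) G P = (H_a ⊕ H_b)(y_a ⊕ y_b) = G_a ⊕ G_b`
  have hG' : twistGram σ G Pm = finSum 2 1 (Ha * ya) (Hb * yb) := by
    rw [← finSum_mul_finSum', ← hP, ← hy, twistGram_def]
    calc (Pm.map σ)ᵀ * G * Pm = (Pm.map σ)ᵀ * (H * (H⁻¹ * G)) * Pm := by rw [Matrix.mul_nonsing_inv_cancel_left H G hHdet]
      _ = (Pm.map σ)ᵀ * H * (Pm * Pi) * (H⁻¹ * G) * Pm := by rw [hPmPi, Matrix.mul_one]; simp only [Matrix.mul_assoc]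
      _ = (Pm.map σ)ᵀ * H * Pm * (Pi * x * Pm) := by simp only [hx, Matrix.mul_assoc]
  -- `G_a`, `G_b` hermitian and non-degenerate
  have hG'h : ((twistGram σ G Pm).map σ)ᵀ = twistGram σ G Pm := conjTranspose_twistGram σ G hσσ hG _
  rw [hG', finSum_conjTranspose] at hG'h
  obtain ⟨hGa, hGb⟩ := finSum_injective₂ hG'h
  have hGa0 : (Ha * ya).det ≠ 0 := by
    rw [Matrix.det_mul]; exact mul_ne_zero hHa0 hydet.1.ne_zero
  have hGb0 : (Hb * yb).det ≠ 0 := by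
    rw [Matrix.det_mul]; exact mul_ne_zero hHb0 hydet.2.ne_zero
  -- (iv) the adelic `t` conjugated into the frame is block diagonal with invertible blocks
  set PA : GL (Fin 3) (AdeleRing (𝓞 L) L) := Matrix.GeneralLinearGroup.map ι P with hPA
  have hPAm : ((PA : GL (Fin 3) (AdeleRing (𝓞 L) L)) : Matrix (Fin 3) (Fin 3) (AdeleRing (𝓞 L) L)) = Pm.map ι := rfl
  have hPAi : (((PA⁻¹ : GL (Fin 3) (AdeleRing (𝓞 L) L))) : Matrix (Fin 3) (Fin 3) (AdeleRing (𝓞 L) L)) = Pi.map ι := by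
    rw [hPA, ← map_inv]; rfl
  set t' : GL (Fin 3) (AdeleRing (𝓞 L) L) := PA⁻¹ * t * PA with ht'def
  have ht'm : ((t' : GL (Fin 3) (AdeleRing (𝓞 L) L)) : Matrix (Fin 3) (Fin 3) (AdeleRing (𝓞 L) L)) =
      Pi.map ι * (t : Matrix (Fin 3) (Fin 3) (AdeleRing (𝓞 L) L)) * Pm.map ι := by
    rw [ht'def, Units.val_mul, Units.val_mul, hPAm, hPAi]
  have hDA : (Pi * γ * Pm).map ι = finSum 2 1 (ι a • (1 : Matrix (Fin 2) (Fin 2) (AdeleRing (𝓞 L) L))) (ι b • (1 : Matrix (Fin 1) (Fin 1) (AdeleRing (𝓞 L) L))) := by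
    rw [hPγP, hD, finSum_smul_one_map]
  have ht'D : ((t' : GL (Fin 3) (AdeleRing (𝓞 L) L)) : Matrix (Fin 3) (Fin 3) (AdeleRing (𝓞 L) L)) *
        finSum 2 1 (ι a • (1 : Matrix (Fin 2) (Fin 2) (AdeleRing (𝓞 L) L))) (ι b • 1) =
      finSum 2 1 (ι a • (1 : Matrix (Fin 2) (Fin 2) (AdeleRing (𝓞 L) L))) (ι b • 1) *
        ((t' : GL (Fin 3) (AdeleRing (𝓞 L) L)) : Matrix (Fin 3) (Fin 3) (AdeleRing (𝓞 L) L)) := by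
    rw [← hDA, Matrix.map_mul, Matrix.map_mul, ht'm, ← hPAm, ← hPAi]
    exact conj_mul_conj_comm PA ht
  have habA : IsUnit (ι a - ι b) := by rw [← map_sub]; exact hab'.map ι
  obtain ⟨ta, tb, htab⟩ := exists_units_eq_finSum_of_commute (N₁ := 2) (N₂ := 1) habA t' ht'D
  -- (v) the adelic congruence in the frame, block by block
  have hPA1 : Pm.map ι * Pi.map ι = 1 := by rw [← Matrix.map_mul, hPmPi, Matrix.map_one ι (map_zero ι) (map_one ι)]
  have hframe : twistGram σA ((twistGram σ G Pm).map ι) ((t' : GL (Fin 3) (AdeleRing (𝓞 L) L)) : Matrix (Fin 3) (Fin 3) (AdeleRing (𝓞 L) L)) =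
      (finSum 2 1 Ha Hb).map ι := by
    calc twistGram σA ((twistGram σ G Pm).map ι) ((t' : GL (Fin 3) (AdeleRing (𝓞 L) L)) : Matrix (Fin 3) (Fin 3) (AdeleRing (𝓞 L) L))
          = twistGram σA (G.map ι) (Pm.map ι * (Pi.map ι * (t : Matrix (Fin 3) (Fin 3) (AdeleRing (𝓞 L) L)) * Pm.map ι)) := by
            rw [twistGram_map σ G σA ι hισ, ht'm, twistGram_mul σA (G.map ι) (Pm.map ι), twistGram_def σA (twistGram σA (G.map ι) (Pm.map ι))]
      _ = twistGram σA (G.map ι) ((t : Matrix (Fin 3) (Fin 3) (AdeleRing (𝓞 L) L)) * Pm.map ι) := by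
            rw [← Matrix.mul_assoc, ← Matrix.mul_assoc, hPA1, Matrix.one_mul]
      _ = ((Pm.map ι).map σA)ᵀ * H.map ι * Pm.map ι := by rw [twistGram_mul, htG]
      _ = (twistGram σ H Pm).map ι := by rw [twistGram_map σ H σA ι hισ, twistGram_def]
      _ = (finSum 2 1 Ha Hb).map ι := by rw [twistGram_def, hP]
  rw [hG', finSum_map, finSum_map, htab, twistGram_finSum_finSum] at hframe
  obtain ⟨hEa, hEb⟩ := finSum_injective₂ hframe
  -- (vi) the Hasse principle for hermitian forms, twice
  obtain ⟨sa, hsa⟩ := Literature.NumberTheory.QuadraticForms.exists_gl_twistGram_eq_of_twistGram_adele' L 2 hGa hHa hGa0 hHa0 ta hEa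
  obtain ⟨sb, hsb⟩ := Literature.NumberTheory.QuadraticForms.exists_gl_twistGram_eq_of_twistGram_adele' L 1 hGb hHb hGb0 hHb0 tb hEb
  -- (vii) the rational conjugator `t₀ := P (s_a ⊕ s_b) P⁻¹`
  set S : GL (Fin 3) L := UnitaryGroup.reindexGL finSumFinEquiv (blockDiagGL (sa, sb)) with hSdef
  have hSm : ((S : GL (Fin 3) L) : Matrix (Fin 3) (Fin 3) L) = finSum 2 1 (sa : Matrix (Fin 2) (Fin 2) L) (sb : Matrix (Fin 1) (Fin 1) L) := by
    rw [hSdef, UnitaryGroup.coe_reindexGL, coe_blockDiagGL, finSum, Matrix.reindex_apply]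
  refine ⟨P * S * P⁻¹, ?_, ?_⟩
  · -- commutes with `γ = P D P⁻¹`
    rw [Units.val_mul, Units.val_mul, hγ, hSm]
    calc Pm * finSum 2 1 (sa : Matrix (Fin 2) (Fin 2) L) (sb : Matrix (Fin 1) (Fin 1) L) * Pi * (Pm * D * Pi)
          = Pm * (finSum 2 1 (sa : Matrix (Fin 2) (Fin 2) L) (sb : Matrix (Fin 1) (Fin 1) L) * D) * Pi := by
            simp only [Matrix.mul_assoc, hPiPm']
      _ = Pm * (D * finSum 2 1 (sa : Matrix (Fin 2) (Fin 2) L) (sb : Matrix (Fin 1) (Fin 1) L)) * Pi := by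
            rw [hD, finSum_commute_finSum_smul_one]
      _ = Pm * D * Pi * (Pm * finSum 2 1 (sa : Matrix (Fin 2) (Fin 2) L) (sb : Matrix (Fin 1) (Fin 1) L) * Pi) := by
            simp only [Matrix.mul_assoc, hPiPm']
  · -- `ᵗ(σ t₀) G t₀ = H`
    have hS' : (((S : GL (Fin 3) L) : Matrix (Fin 3) (Fin 3) L).map σ)ᵀ * finSum 2 1 (Ha * ya) (Hb * yb) * ((S : GL (Fin 3) L) : Matrix (Fin 3) (Fin 3) L) =
        finSum 2 1 Ha Hb := by
      rw [hSm, ← twistGram_def σ (finSum 2 1 (Ha * ya) (Hb * yb)) (finSum 2 1 (sa : Matrix (Fin 2) (Fin 2) L) (sb : Matrix (Fin 1) (Fin 1) L)),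
        twistGram_finSum_finSum, hsa, hsb]
    rw [Units.val_mul, Units.val_mul, twistGram_mul, twistGram_mul, hG', hS', ← hP]
    calc (Pi.map σ)ᵀ * ((Pm.map σ)ᵀ * H * Pm) * Pi = ((Pm * Pi).map σ)ᵀ * H * (Pm * Pi) := by
            rw [Matrix.map_mul, Matrix.transpose_mul]; simp only [Matrix.mul_assoc]
      _ = H := by rw [hPmPi, Matrix.map_one σ (map_zero σ) (map_one σ), Matrix.transpose_one, Matrix.one_mul, Matrix.mul_one]

end Descent

/-! ## §3 `k(γ₀) = 1` at every class of the anisotropic `U(H)(L⁺)` in three variables -/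

section Unitary

variable {L : Type} [Field L] [NumberField L] [IsCMField L] {H : Matrix (Fin 3) (Fin 3) L}

/-- **ADELIC CONJUGACY ⇒ RATIONAL CONJUGACY AT A SINGULAR CLASS.**  `H ∈ M₃(L)` ANISOTROPIC hermitian over the CM field `L`; `γ, γ′ ∈ U(H)(L⁺)` STABLY
conjugate with `γ` NOT regular (a singular semisimple class: central, or eigenvalues `{a, a, b}` [§3.8]); if `γ ⊗ 1` and `γ′ ⊗ 1` are conjugate in
`U(H)(𝔸_{L⁺})`, then `γ` and `γ′` are conjugate in `U(H)(L⁺)` — §2 in the frame of ★ `exists_singular_frame_of_anisotropic`, closed by ★ R1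
`exists_unitary_conj_iff_exists_commute_congr_eq`; the central case is `γ′ = γ`.  (For `γ` REGULAR this is ★ `UnitaryGroup.isConj_of_isConj_toAdelic`.)
[cite: Rogawski1990, §3.8 Prop. 3.8.1 p. 27; §5.4 p. 72; §14.5 p. 239] [cite: Kottwitz1986, §9] [cite: Landherr1936HermitianForms] -/
theorem UnitaryGroup.isConj_of_isConj_toAdelic_of_not_isRegularElt (hH : (H.map (cmConjRingHom L))ᵀ = H) (hHdet : IsUnit H.det)
    (hanis : ∀ x : Fin 3 → L, Literature.AlgebraicGeometry.ShimuraVarieties.hermForm (cmConjRingHom L) H x x = 0 → x = 0)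
    {γ γ' : (UnitaryGroup.cmDatum L 3 H).Rational} (hst : IsStablyConj (cmConjRingHom L) H γ γ')
    (hnreg : ¬ IsRegularElt ((γ : unitaryGroup (cmConjRingHom L) H).val : GL (Fin 3) L))
    (h : IsConj ((UnitaryGroup.cmDatum L 3 H).toAdelic γ) ((UnitaryGroup.cmDatum L 3 H).toAdelic γ')) : IsConj γ γ' := by
  classical
  set σ : L →+* L := cmConjRingHom L with hσdef
  have hσσ : ∀ r : L, σ (σ r) = r := fun r => IsCMField.complexConj_apply_apply L r
  obtain ⟨g, hg⟩ := isStablyConj_iff.1 hst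
  by_cases hsc : ∃ ζ : L, (((γ : unitaryGroup σ H).val : GL (Fin 3) L) : Matrix (Fin 3) (Fin 3) L) = ζ • (1 : Matrix (Fin 3) (Fin 3) L)
  · -- CENTRAL: `γ′ = g γ g⁻¹ = γ`
    obtain ⟨ζ, hζ⟩ := hsc
    have hγγ' : γ = γ' := by
      apply Subtype.ext
      apply Units.ext
      rw [← hg, Units.val_mul, Units.val_mul, hζ, Matrix.mul_smul, Matrix.mul_one, Matrix.smul_mul, ← Units.val_mul, mul_inv_cancel,
        Units.val_one]
    rw [hγγ']
  · -- SINGULAR NON-CENTRAL: the frame, the descent §2, and R1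
    push Not at hsc
    obtain ⟨a, b, P, Ha, Hb, hab, -, -, hP, hγP, hHa, hHb, hHa0, hHb0⟩ :=
      exists_singular_frame_of_anisotropic σ hσσ H hH hHdet.ne_zero hanis (γ : unitaryGroup σ H) hnreg hsc
    -- ★ F3′ (b): the adelic witness commuting with `γ ⊗ 1`
    obtain ⟨t, ht, hHt⟩ := exists_commute_congr_twistGram_map_of_isConj_toAdelic hg h
    have ht' : (t : Matrix (Fin 3) (Fin 3) (AdeleRing (𝓞 L) L)) *
        ((((γ : unitaryGroup σ H).val : GL (Fin 3) L) : Matrix (Fin 3) (Fin 3) L)).map (algebraMap L (AdeleRing (𝓞 L) L)) =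
        ((((γ : unitaryGroup σ H).val : GL (Fin 3) L) : Matrix (Fin 3) (Fin 3) L)).map (algebraMap L (AdeleRing (𝓞 L) L)) *
          (t : Matrix (Fin 3) (Fin 3) (AdeleRing (𝓞 L) L)) := congrArg Units.val ht
    -- the hermitian form `G := H_g`
    have hGh : ((twistGram σ H (g : Matrix (Fin 3) (Fin 3) L)).map σ)ᵀ = twistGram σ H (g : Matrix (Fin 3) (Fin 3) L) :=
      conjTranspose_twistGram σ H hσσ hH _
    have hGdet : IsUnit (twistGram σ H (g : Matrix (Fin 3) (Fin 3) L)).det := by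
      rw [twistGram_def, Matrix.det_mul, Matrix.det_mul, Matrix.det_transpose, ← RingHom.mapMatrix_apply, ← RingHom.map_det]
      exact (((Matrix.isUnits_det_units g).map σ).mul hHdet).mul (Matrix.isUnits_det_units g)
    have hGγ := (commute_inv_mul_twistGram σ H hHdet hg).eq
    obtain ⟨t₀, ht₀, ht₀G⟩ := exists_commute_twistGram_eq_of_singular_frame hHdet hab hHa hHb hHa0 hHb0 hP hγP hGh hGdet hGγ t ht'
      (by rw [twistGram_def]; exact hHt)
    -- ★ R1 at `R := L`
    refine isConj_of_exists_unitary_conj ((exists_unitary_conj_iff_exists_commute_congr_eq σ H hg).2 ⟨t₀, Units.ext ht₀, ?_⟩)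
    rw [← twistGram_def]
    exact ht₀G

/-- **`k(γ₀) = 1` AT EVERY CLASS, regularity-free** (the `hinj` hypothesis of ★ `PreStabilisationCount{,Self}` for ALL `γ₀`): for `H ∈ M₃(L)` ANISOTROPIC
hermitian and any `γ₀ ∈ U(H)(L⁺)`, the map `[δ] ↦ [δ ⊗ 1]` is INJECTIVE on the `U(H)(L⁺)`-classes inside the stable class of `γ₀` — regular `γ₀` by ★ F3′
`UnitaryGroup.injOn_conjClassesMap_toAdelic`, singular `γ₀` by `isConj_of_isConj_toAdelic_of_not_isRegularElt`.
[cite: Rogawski1990, §5.4 p. 72; §14.5 pp. 238–239] [cite: Kottwitz1986, §9] -/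
theorem UnitaryGroup.injOn_conjClassesMap_toAdelic_of_anisotropic (hH : (H.map (cmConjRingHom L))ᵀ = H) (hHdet : IsUnit H.det)
    (hanis : ∀ x : Fin 3 → L, Literature.AlgebraicGeometry.ShimuraVarieties.hermForm (cmConjRingHom L) H x x = 0 → x = 0)
    (γ₀ : (UnitaryGroup.cmDatum L 3 H).Rational) :
    Set.InjOn (ConjClasses.map (UnitaryGroup.cmDatum L 3 H).toAdelic) (conjClassesIn (cmConjRingHom L) H γ₀) := by
  by_cases hreg : IsRegularElt ((γ₀ : unitaryGroup (cmConjRingHom L) H).val : GL (Fin 3) L)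
  · exact UnitaryGroup.injOn_conjClassesMap_toAdelic hH hHdet hreg
  · rintro c₁ hc₁ c₂ hc₂ hc
    obtain ⟨δ₁, rfl⟩ := ConjClasses.mk_surjective c₁
    obtain ⟨δ₂, rfl⟩ := ConjClasses.mk_surjective c₂
    have h₁ : IsStablyConj (cmConjRingHom L) H γ₀ δ₁ := mk_mem_conjClassesIn_iff.1 hc₁
    have h₂ : IsStablyConj (cmConjRingHom L) H γ₀ δ₂ := mk_mem_conjClassesIn_iff.1 hc₂
    have hnreg₁ : ¬ IsRegularElt ((δ₁ : unitaryGroup (cmConjRingHom L) H).val : GL (Fin 3) L) :=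
      fun hr => hreg (isRegularElt_of_isConj h₁.symm hr)
    have hc' : ConjClasses.mk ((UnitaryGroup.cmDatum L 3 H).toAdelic δ₁) = ConjClasses.mk ((UnitaryGroup.cmDatum L 3 H).toAdelic δ₂) := hc
    exact ConjClasses.mk_eq_mk_iff_isConj.2 (UnitaryGroup.isConj_of_isConj_toAdelic_of_not_isRegularElt hH hHdet hanis (h₁.symm.trans h₂) hnreg₁
      (ConjClasses.mk_eq_mk_iff_isConj.1 hc'))

end Unitary

end Literature.NumberTheory.Rogawski1990

end
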